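import Mathlib
import Literature.Probability.LatticeModels.TorusFourierProofs

/-!
# Route BalabanIR — crux 3 `BirBdGPhaseCoercivity` (item `stmt-HubbardSuperconductivity-2081`):
# II. The plane-wave change of basis on `(ℤ/L)^d`

Second file of the frozen-Nambu-metric reduction of the phase-coercivity crux (ideas
`frozen-nambu-metric`, `sqrt-concavity-multiplier`). Conjugation by the (unnormalised) plane-wave
matrix `W_{kx} = conj χ_k(x)` of `(ℤ/L)^d`, `A^ := L^{-d} W A Wᴴ` (`Wᴴ W = W Wᴴ = L^d`), is a
trace-preserving, multiplicative, `ᴴ`-compatible injection (stated for any `W` with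
`Wᴴ W = W Wᴴ = N·1`, so that the Nambu doubling `W ⊕ W` is covered by the same lemmas); it
diagonalises circulant (translation-invariant) matrices, `(circulant v)^ = diagonal (FT v)`
(`FT = torusFourier`, the symbol), and sends a multiplication operator `diagonal u` to the
convolution kernel `L^{-d} û(k' - k)`, `û(q) = Σ_x u_x χ_q(x)`.

References: Friedli–Velenik 2017, §10.4 (Fourier analysis on the discrete torus); Stein–Shakarchi,
*Fourier Analysis*, Ch. 7. No definition is introduced.
-/

noncomputable section

namespace Summit.HubbardSuperconductivity.HubbardSuperconductivity.Theorems

namespace BirBdG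

open Matrix Finset Literature.Probability.LatticeModels
open scoped ComplexConjugate ComplexOrder

/-! ### Conjugation by an `N`-scaled unitary -/

section Scaled

variable {m : Type*} [Fintype m] [DecidableEq m] {W : Matrix m m ℂ} {N : ℕ}

/-- `A^ B^ = (A B)^` for `A^ = N⁻¹ W A Wᴴ` when `Wᴴ W = N`. [folklore] -/
theorem hat_mul (hN : N ≠ 0) (h1 : Wᴴ * W = (N : ℂ) • (1 : Matrix m m ℂ)) (A B : Matrix m m ℂ) :
    ((N : ℂ)⁻¹ • (W * A * Wᴴ)) * ((N : ℂ)⁻¹ • (W * B * Wᴴ)) = (N : ℂ)⁻¹ • (W * (A * B) * Wᴴ) := by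
  have hN' : (N : ℂ) ≠ 0 := Nat.cast_ne_zero.2 hN
  rw [Matrix.smul_mul, Matrix.mul_smul, smul_smul]
  have : W * A * Wᴴ * (W * B * Wᴴ) = (N : ℂ) • (W * (A * B) * Wᴴ) := by
    calc W * A * Wᴴ * (W * B * Wᴴ) = W * A * (Wᴴ * W) * B * Wᴴ := by
          simp only [Matrix.mul_assoc]
      _ = (N : ℂ) • (W * (A * B) * Wᴴ) := by
          rw [h1, Matrix.mul_smul, Matrix.mul_one, Matrix.smul_mul, Matrix.smul_mul]
          simp only [Matrix.mul_assoc]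
  rw [this, smul_smul, inv_mul_cancel_right₀ hN']

/-- `1^ = 1` when `W Wᴴ = N`. [folklore] -/
theorem hat_one (hN : N ≠ 0) (h2 : W * Wᴴ = (N : ℂ) • (1 : Matrix m m ℂ)) :
    (N : ℂ)⁻¹ • (W * (1 : Matrix m m ℂ) * Wᴴ) = 1 := by
  have hN' : (N : ℂ) ≠ 0 := Nat.cast_ne_zero.2 hN
  rw [Matrix.mul_one, h2, smul_smul, inv_mul_cancel₀ hN', one_smul]

omit [DecidableEq m] in
/-- `(Aᴴ)^ = (A^)ᴴ`. [folklore] -/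
theorem hat_conjTranspose (A : Matrix m m ℂ) :
    (N : ℂ)⁻¹ • (W * Aᴴ * Wᴴ) = ((N : ℂ)⁻¹ • (W * A * Wᴴ))ᴴ := by
  rw [Matrix.conjTranspose_smul, Matrix.conjTranspose_mul, Matrix.conjTranspose_mul,
    Matrix.conjTranspose_conjTranspose, Matrix.mul_assoc]
  congr 1
  rw [star_inv₀]
  simp

/-- `Tr A^ = Tr A` when `Wᴴ W = N`. [folklore] -/
theorem trace_hat (hN : N ≠ 0) (h1 : Wᴴ * W = (N : ℂ) • (1 : Matrix m m ℂ)) (A : Matrix m m ℂ) :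
    ((N : ℂ)⁻¹ • (W * A * Wᴴ)).trace = A.trace := by
  have hN' : (N : ℂ) ≠ 0 := Nat.cast_ne_zero.2 hN
  rw [Matrix.trace_smul, Matrix.trace_mul_cycle, h1, Matrix.smul_mul,
    Matrix.one_mul, Matrix.trace_smul, smul_eq_mul, smul_eq_mul, inv_mul_cancel_left₀ hN']

/-- Inversion: `A = N⁻¹ Wᴴ A^ W` when `Wᴴ W = N`. [folklore] -/
theorem unhat_hat (hN : N ≠ 0) (h1 : Wᴴ * W = (N : ℂ) • (1 : Matrix m m ℂ)) (A : Matrix m m ℂ) :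
    (N : ℂ)⁻¹ • (Wᴴ * ((N : ℂ)⁻¹ • (W * A * Wᴴ)) * W) = A := by
  have hN' : (N : ℂ) ≠ 0 := Nat.cast_ne_zero.2 hN
  rw [Matrix.mul_smul, Matrix.smul_mul, smul_smul]
  have : Wᴴ * (W * A * Wᴴ) * W = ((N : ℂ) * (N : ℂ)) • A := by
    calc Wᴴ * (W * A * Wᴴ) * W = (Wᴴ * W) * A * (Wᴴ * W) := by simp only [Matrix.mul_assoc]
      _ = ((N : ℂ) * (N : ℂ)) • A := by
          rw [h1, Matrix.smul_mul, Matrix.one_mul, Matrix.mul_smul, Matrix.mul_one, smul_smul]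
  rw [this, smul_smul]
  field_simp
  rw [one_smul]

/-- The conjugation `A ↦ A^` is injective when `Wᴴ W = N`. [folklore] -/
theorem hat_injective (hN : N ≠ 0) (h1 : Wᴴ * W = (N : ℂ) • (1 : Matrix m m ℂ)) {A B : Matrix m m ℂ}
    (h : (N : ℂ)⁻¹ • (W * A * Wᴴ) = (N : ℂ)⁻¹ • (W * B * Wᴴ)) : A = B := by
  rw [← unhat_hat hN h1 A, ← unhat_hat hN h1 B, h]

/-- The inverse conjugation `D ↦ N⁻¹ Wᴴ D W` followed by `^` is the identity when `W Wᴴ = N`. [folklore] -/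
theorem hat_unhat (hN : N ≠ 0) (h2 : W * Wᴴ = (N : ℂ) • (1 : Matrix m m ℂ)) (D : Matrix m m ℂ) :
    (N : ℂ)⁻¹ • (W * ((N : ℂ)⁻¹ • (Wᴴ * D * W)) * Wᴴ) = D := by
  have := unhat_hat (W := Wᴴ) hN (by rwa [Matrix.conjTranspose_conjTranspose]) D
  rwa [Matrix.conjTranspose_conjTranspose] at this

/-- The inverse conjugation preserves positive definiteness (`W` is injective). [folklore] -/
theorem posDef_unhat (hN : N ≠ 0) (h1 : Wᴴ * W = (N : ℂ) • (1 : Matrix m m ℂ)) {D : Matrix m m ℂ}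
    (hD : D.PosDef) : ((N : ℂ)⁻¹ • (Wᴴ * D * W)).PosDef := by
  have hN' : (N : ℂ) ≠ 0 := Nat.cast_ne_zero.2 hN
  have hWu : IsUnit W := by
    refine IsUnit.of_mul_eq_one_right ((N : ℂ)⁻¹ • Wᴴ) ?_
    rw [Matrix.smul_mul, h1, smul_smul, inv_mul_cancel₀ hN', one_smul]
  have h : (Wᴴ * D * W).PosDef :=
    hD.conjTranspose_mul_mul_same (Matrix.mulVec_injective_of_isUnit hWu)
  have hpos : (0 : ℂ) < (N : ℂ)⁻¹ := by
    have h0 : (0 : ℝ) < (N : ℝ)⁻¹ := inv_pos.2 (by exact_mod_cast Nat.pos_of_ne_zero hN)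
    have h1 : (0 : ℂ) < ((N : ℝ)⁻¹ : ℝ) := Complex.zero_lt_real.2 h0
    convert h1 using 1
    push_cast
    rfl
  exact h.smul hpos

/-- Block-diagonal doubling: `(W ⊕ W)ᴴ (W ⊕ W) = N` from `Wᴴ W = N`. [folklore] -/
theorem fromBlocks_conjTranspose_mul_self (h1 : Wᴴ * W = (N : ℂ) • (1 : Matrix m m ℂ)) :
    (Matrix.fromBlocks W 0 0 W)ᴴ * Matrix.fromBlocks W 0 0 W =
      (N : ℂ) • (1 : Matrix (m ⊕ m) (m ⊕ m) ℂ) := by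
  rw [Matrix.fromBlocks_conjTranspose, Matrix.fromBlocks_multiply]
  simp only [Matrix.conjTranspose_zero, Matrix.zero_mul, Matrix.mul_zero, add_zero, zero_add, h1]
  rw [← Matrix.fromBlocks_one, Matrix.fromBlocks_smul, smul_zero]

/-- Block-diagonal doubling: `(W ⊕ W) (W ⊕ W)ᴴ = N` from `W Wᴴ = N`. [folklore] -/
theorem fromBlocks_mul_conjTranspose_self (h2 : W * Wᴴ = (N : ℂ) • (1 : Matrix m m ℂ)) :
    Matrix.fromBlocks W 0 0 W * (Matrix.fromBlocks W 0 0 W)ᴴ =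
      (N : ℂ) • (1 : Matrix (m ⊕ m) (m ⊕ m) ℂ) := by
  rw [Matrix.fromBlocks_conjTranspose, Matrix.fromBlocks_multiply]
  simp only [Matrix.conjTranspose_zero, Matrix.zero_mul, Matrix.mul_zero, add_zero, zero_add, h2]
  rw [← Matrix.fromBlocks_one, Matrix.fromBlocks_smul, smul_zero]

omit [Fintype m] [DecidableEq m] in
/-- The doubled conjugation acts blockwise. [folklore] -/
theorem hat_fromBlocks [Fintype m] (A B C D : Matrix m m ℂ) :
    (N : ℂ)⁻¹ • (Matrix.fromBlocks W 0 0 W * Matrix.fromBlocks A B C D * (Matrix.fromBlocks W 0 0 W)ᴴ) =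
      Matrix.fromBlocks ((N : ℂ)⁻¹ • (W * A * Wᴴ)) ((N : ℂ)⁻¹ • (W * B * Wᴴ))
        ((N : ℂ)⁻¹ • (W * C * Wᴴ)) ((N : ℂ)⁻¹ • (W * D * Wᴴ)) := by
  rw [Matrix.fromBlocks_conjTranspose, Matrix.fromBlocks_multiply, Matrix.fromBlocks_multiply,
    Matrix.fromBlocks_smul]
  simp

end Scaled

/-! ### The plane-wave matrix of `(ℤ/L)^d` -/

section PlaneWave

variable {d L : ℕ} [NeZero L]

/-- `Wᴴ W = L^d` for `W_{kx} = conj χ_k(x)` (orthogonality of characters, summed over `k`). [cite: FriedliVelenik2017, §10.4] -/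
theorem planeWave_conjTranspose_mul_self :
    (Matrix.of fun k x : TorusSite d L => conj (torusChar k x))ᴴ *
        Matrix.of (fun k x : TorusSite d L => conj (torusChar k x)) =
      ((L ^ d : ℕ) : ℂ) • (1 : Matrix (TorusSite d L) (TorusSite d L) ℂ) := by
  ext x y
  rw [Matrix.mul_apply, Matrix.smul_apply, Matrix.one_apply]
  simp only [Matrix.conjTranspose_apply, Matrix.of_apply, Complex.star_def, Complex.conj_conj]
  have : ∀ k : TorusSite d L, torusChar k x * conj (torusChar k y) = torusChar k (x - y) := fun k => by
    rw [torusChar_sub_right]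
  simp_rw [this, sum_torusChar_left, sub_eq_zero]
  by_cases h : x = y
  · simp [h]
  · simp [h]

/-- `W Wᴴ = L^d` for `W_{kx} = conj χ_k(x)` (orthogonality of characters, summed over `x`). [cite: FriedliVelenik2017, §10.4] -/
theorem planeWave_mul_conjTranspose_self :
    Matrix.of (fun k x : TorusSite d L => conj (torusChar k x)) *
        (Matrix.of fun k x : TorusSite d L => conj (torusChar k x))ᴴ =
      ((L ^ d : ℕ) : ℂ) • (1 : Matrix (TorusSite d L) (TorusSite d L) ℂ) := by
  ext k k'
  rw [Matrix.mul_apply, Matrix.smul_apply, Matrix.one_apply]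
  simp only [Matrix.conjTranspose_apply, Matrix.of_apply, Complex.star_def, Complex.conj_conj]
  have : ∀ x : TorusSite d L, conj (torusChar k x) * torusChar k' x = torusChar (k' - k) x := fun x => by
    rw [torusChar_sub_left, mul_comm]
  simp_rw [this, sum_torusChar_right, sub_eq_zero]
  by_cases h : k = k'
  · simp [h]
  · simp [h, Ne.symm h]

/-- **Plane waves diagonalise circulant matrices**: `(circulant v)^ = diagonal (FT v)` with the
symbol `FT v (k) = Σ_r v(r) conj χ_k(r)` (`torusFourier`). [cite: FriedliVelenik2017, §10.4] -/
theorem hat_circulant (v : TorusSite d L → ℂ) :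
    ((L ^ d : ℕ) : ℂ)⁻¹ • (Matrix.of (fun k x : TorusSite d L => conj (torusChar k x)) *
        Matrix.circulant v * (Matrix.of fun k x : TorusSite d L => conj (torusChar k x))ᴴ) =
      Matrix.diagonal (torusFourier v) := by
  have hN : ((L ^ d : ℕ) : ℂ) ≠ 0 := by exact_mod_cast pow_ne_zero d (NeZero.ne L)
  -- the plane waves are eigenvectors: `Σ_y v(x - y) χ_{k'}(y) = FTv(k') χ_{k'}(x)`
  have heig : ∀ (k' x : TorusSite d L),
      ∑ y, v (x - y) * torusChar k' y = torusFourier v k' * torusChar k' x := by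
    intro k' x
    rw [torusFourier_eq_sum_torusChar, Finset.sum_mul]
    rw [← Equiv.sum_comp (Equiv.subLeft x)]
    refine Finset.sum_congr rfl fun r _ => ?_
    simp only [Equiv.subLeft_apply, sub_sub_cancel]
    rw [torusChar_sub_right]
    ring
  have hCW : Matrix.circulant v * (Matrix.of fun k x : TorusSite d L => conj (torusChar k x))ᴴ =
      Matrix.of fun y k' => torusFourier v k' * torusChar k' y := by
    ext y k'
    rw [Matrix.mul_apply]
    simp only [Matrix.conjTranspose_apply, Matrix.of_apply, Matrix.circulant_apply,
      Complex.star_def, Complex.conj_conj]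
    exact heig k' y
  ext k k'
  rw [Matrix.smul_apply, Matrix.mul_assoc, hCW, Matrix.mul_apply, Matrix.diagonal_apply]
  simp only [Matrix.of_apply]
  have : ∀ y, conj (torusChar k y) * (torusFourier v k' * torusChar k' y) =
      torusFourier v k' * torusChar (k' - k) y := by
    intro y
    rw [torusChar_sub_left]
    ring
  simp_rw [this, ← Finset.mul_sum, sum_torusChar_right, sub_eq_zero]
  by_cases h : k = k'
  · subst h
    simp only [if_true, smul_eq_mul, Nat.cast_pow]
    have hL : (L : ℂ) ^ d ≠ 0 := pow_ne_zero d (Nat.cast_ne_zero.2 (NeZero.ne L))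
    field_simp
  · simp [h, Ne.symm h]

/-- **Plane-wave matrix elements of a multiplication operator**: `(diagonal u)^_{kk'} =
L^{-d} Σ_x u_x χ_{k'-k}(x)` — a convolution kernel in momentum space. [cite: FriedliVelenik2017, §10.4] -/
theorem hat_diagonal_apply (u : TorusSite d L → ℂ) (k k' : TorusSite d L) :
    (((L ^ d : ℕ) : ℂ)⁻¹ • (Matrix.of (fun k x : TorusSite d L => conj (torusChar k x)) *
        Matrix.diagonal u * (Matrix.of fun k x : TorusSite d L => conj (torusChar k x))ᴴ)) k k' =
      ((L ^ d : ℕ) : ℂ)⁻¹ * ∑ x, u x * torusChar (k' - k) x := by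
  rw [Matrix.smul_apply, smul_eq_mul, Matrix.mul_apply]
  congr 1
  refine Finset.sum_congr rfl fun x _ => ?_
  rw [Matrix.mul_diagonal (d := u)]
  simp only [Matrix.conjTranspose_apply, Matrix.of_apply, Complex.star_def, Complex.conj_conj]
  rw [torusChar_sub_left]
  ring

/-- **Shifted autocorrelation in Fourier variables**:
`Σ_x u_x conj u_{x+e} = L^{-d} Σ_q ‖û(q)‖² χ_q(e)` with `û(q) = Σ_x u_x χ_q(x)` (Wiener–Khinchin on
the discrete torus). [cite: FriedliVelenik2017, §10.4] -/
theorem sum_mul_conj_shift_eq (u : TorusSite d L → ℂ) (e : TorusSite d L) :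
    ∑ x, u x * conj (u (x + e)) =
      ((L ^ d : ℕ) : ℂ)⁻¹ * ∑ q, ((‖∑ x, u x * torusChar q x‖ ^ 2 : ℝ) : ℂ) * torusChar q e := by
  have hN : ((L ^ d : ℕ) : ℂ) ≠ 0 := by exact_mod_cast pow_ne_zero d (NeZero.ne L)
  -- expand `‖û(q)‖² χ_q(e) = Σ_{x,y} u_x conj u_y χ_q(x - y + e)`
  have hq : ∀ q : TorusSite d L,
      ((‖∑ x, u x * torusChar q x‖ ^ 2 : ℝ) : ℂ) * torusChar q e =
        ∑ x, ∑ y, u x * conj (u y) * torusChar q (x - y + e) := by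
    intro q
    rw [← Complex.normSq_eq_norm_sq, ← Complex.mul_conj, map_sum, Finset.sum_mul_sum,
      Finset.sum_mul]
    refine Finset.sum_congr rfl fun x _ => ?_
    rw [Finset.sum_mul]
    refine Finset.sum_congr rfl fun y _ => ?_
    rw [map_mul, torusChar_add_right, torusChar_sub_right]
    ring
  simp_rw [hq]
  rw [Finset.sum_comm]
  have hx : ∀ x, ∑ q, ∑ y, u x * conj (u y) * torusChar q (x - y + e) =
      ((L ^ d : ℕ) : ℂ) * (u x * conj (u (x + e))) := by
    intro x
    rw [Finset.sum_comm]
    have : ∀ y, ∑ q, u x * conj (u y) * torusChar q (x - y + e) =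
        u x * conj (u y) * ∑ q, torusChar q (x - y + e) := fun y => by rw [Finset.mul_sum]
    simp_rw [this, sum_torusChar_left]
    simp_rw [mul_ite, mul_zero]
    rw [Finset.sum_ite, Finset.sum_const_zero, add_zero]
    have hfilter : (Finset.univ.filter fun y : TorusSite d L => x - y + e = 0) = {x + e} := by
      ext y
      simp only [Finset.mem_filter, Finset.mem_univ, true_and, Finset.mem_singleton]
      constructor
      · intro h
        rw [sub_add_eq_add_sub, sub_eq_zero] at h
        exact h.symm
      · rintro rfl
        abel
    rw [hfilter, Finset.sum_singleton]
    push_cast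
    ring
  simp_rw [hx]
  rw [← Finset.mul_sum, ← mul_assoc, inv_mul_cancel₀ hN, one_mul]

end PlaneWave

end BirBdG

end Summit.HubbardSuperconductivity.HubbardSuperconductivity.Theorems

end
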